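import Literature.MathematicalPhysics.QuantumManyBody.TranslationAveragedDensity
import Literature.MathematicalPhysics.QuantumManyBody.PeriodicClusteringFromKyFanGap
import Literature.MathematicalPhysics.QuantumManyBody.PeriodicBoseGasImpurityTranslation
import HarnessLib

/-!
# Route `BECProbeMassFlow`, crux `RecoilTransfer` (stmt-AtomisticToContinuum-12311):
# stub `stub_boseZeroMomentumAttain`

Support file for the crux `RecoilTransfer` (route `BECProbeMassFlow`, line `registered`, skeleton
`Lines/birth.lean` v4): the stub `stub_boseZeroMomentumAttain` (exact registered name and
signature), **the periodic `M`-boson ground-state energy is approached inside the sector of total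
momentum zero**: for every measurable `v ≥ 0` (hard cores allowed), `0 < L`, every `M` and every
`δ > 0` there is a Bose trial state `Ω₀` with `HasTotalMomentum 0 Ω₀.ψ` and
`⟨Ω₀, H Ω₀⟩ ≤ E(M, L) + δ` — WITHOUT Perron–Frobenius theory. This is the Bose twin of the tagged
`stub_zeroMomentumAttain` (`BECProbeMassFlowRecoilTransferZeroMomentumAttain.lean`).

Proof (the method of `BosonicFloor.lean`, with the compact group of simultaneous translations in
place of the finite group of relabellings; the calculus is in
`Literature/…/TranslationAverageCalculus.lean` and `…/TranslationAveragedDensity.lean`). If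
`E = ⊤` the constant state does it. Otherwise pick `Ω` with `⟨Ω, HΩ⟩ < E + δ`, average its DENSITY
over the translations, `F(X) = ∫_{[0,L)³} |Ω(X + t𝟙)|² dt`, and take the regularised root
`g_ε = √(ε² + F) − ε`: it is `C¹`, periodic, Bose-symmetric and translation INVARIANT (total
momentum `0`); by the convexity inequality for gradients and the translation invariance of the pair
interaction its energy density is at most the translation average of that of `Ω`, so
`𝓔[g_ε] ≤ L³ ⟨Ω, HΩ⟩` (`lintegral_boseEnergyDensity_sqrtTransAvg_le`, Tonelli and the shift of the
fundamental cell), while `‖g_ε‖² → L³` as `ε = 1/(n+1) → 0`. Normalising `g_ε` for `n` large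
(`exists_periodicTrialState_const_mul`, `lintegral_periodicEnergy_const_mul`) gives
`⟨Ω₀, HΩ₀⟩ = 𝓔[g_ε]/‖g_ε‖² ≤ L³⟨Ω, HΩ⟩/‖g_ε‖² < E + δ` eventually.
-/

noncomputable section

open MeasureTheory Filter Topology
open scoped ENNReal NNReal

namespace Summit.AtomisticToContinuum.BoseEinsteinCondensation.Theorems

open Literature.MathematicalPhysics.QuantumManyBody.BoseGas

variable {M : ℕ} {L : ℝ}

/-! ### The energy of the regularised translation average of a Bose state -/

/-- **Pointwise kinetic bound** (convexity inequality for gradients, direction by direction): the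
kinetic density of `g_ε = √(ε² + ∫_{[0,L)³}|Ω(· + t𝟙)|²dt) − ε` is at most the translation average
of that of `Ω`, `|∇g_ε|²(X) ≤ ∫_{[0,L)³} |∇Ω|²(X + t𝟙) dt`. [folklore] -/
theorem kineticDensity_sqrtTransAvg_le (Ω : PeriodicTrialState M L) {ε : ℝ} (hε : 0 < ε)
    (X : Config M) :
    kineticDensity (fun Y : Config M =>
        ((Real.sqrt (ε ^ 2 + ∫ t in cell L, ‖Ω.ψ (Y + fun _ => t)‖ ^ 2) - ε : ℝ) : ℂ)) X ≤
      ∫⁻ t in cell L, kineticDensity Ω.ψ (X + fun _ => t) := by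
  have hb := fun u => nnnorm_fderiv_sqrtTransAvg_sq_le (L := L) Ω.contDiff hε X u
  have hm : ∀ u : Config M, Measurable fun t : Space =>
      ((‖fderiv ℝ Ω.ψ (X + fun _ => t) u‖₊ : ℝ≥0∞)) ^ 2 := fun u =>
    (((Ω.contDiff.continuous_fderiv one_ne_zero).comp
      (continuous_const.add continuous_diagConfig)).clm_apply
        continuous_const).measurable.nnnorm.coe_nnreal_ennreal.pow_const _
  have hrhs : ∫⁻ t in cell L, kineticDensity Ω.ψ (X + fun _ => t) =
      ∑ i : Fin M, ∑ k : Fin 3, ∫⁻ t in cell L, ((‖fderiv ℝ Ω.ψ (X + fun _ => t)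
          (Pi.single i (EuclideanSpace.single k (1 : ℝ)))‖₊ : ℝ≥0∞)) ^ 2 := by
    simp only [kineticDensity]
    rw [lintegral_finsetSum _ fun i _ => Finset.measurable_sum _ fun k _ => hm _]
    exact Finset.sum_congr rfl fun i _ => lintegral_finsetSum _ fun k _ => hm _
  rw [hrhs, kineticDensity]
  exact Finset.sum_le_sum fun i _ => Finset.sum_le_sum fun k _ => hb _

/-- **Pointwise potential bound**: `W(X) g_ε(X)² ≤ ∫_{[0,L)³} W(X + t𝟙)|Ω(X + t𝟙)|² dt` for the
pair interaction `W = ∑_{i<j} v^per(xᵢ - xⱼ)` (`g_ε² ≤ F` and `W` only sees differences of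
positions). [folklore] -/
theorem periodicInteraction_mul_sqrtTransAvg_le (v : ℝ → ℝ≥0∞) (Ω : PeriodicTrialState M L)
    {ε : ℝ} (hε : 0 < ε) (X : Config M) :
    periodicInteraction v L X *
        ((‖((Real.sqrt (ε ^ 2 + ∫ t in cell L, ‖Ω.ψ (X + fun _ => t)‖ ^ 2) - ε : ℝ) : ℂ)‖₊ :
          ℝ≥0∞)) ^ 2 ≤
      ∫⁻ t in cell L, periodicInteraction v L (X + fun _ => t) *
        ((‖Ω.ψ (X + fun _ => t)‖₊ : ℝ≥0∞)) ^ 2 := by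
  have hm : Measurable fun t : Space => ((‖Ω.ψ (X + fun _ => t)‖₊ : ℝ≥0∞)) ^ 2 :=
    (Ω.contDiff.continuous.comp (continuous_const.add
      continuous_diagConfig)).measurable.nnnorm.coe_nnreal_ennreal.pow_const _
  calc _ ≤ periodicInteraction v L X * ∫⁻ t in cell L, ((‖Ω.ψ (X + fun _ => t)‖₊ : ℝ≥0∞)) ^ 2 :=
        mul_le_mul_right (nnnorm_sqrtTransAvg_sq_le Ω.contDiff.continuous hε.le X) _
    _ = ∫⁻ t in cell L, periodicInteraction v L X * ((‖Ω.ψ (X + fun _ => t)‖₊ : ℝ≥0∞)) ^ 2 :=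
        (lintegral_const_mul _ hm).symm
    _ = _ := by simp only [periodicInteraction_add_const]

/-- **Energy of the regularised translation average of a Bose state.** For measurable `v`, a
periodic trial state `Ω` on a torus of side `L > 0` and `ε > 0`,
`∫_{[0,L)^{3M}} (|∇g_ε|² + W g_ε²) ≤ L³ · ⟨Ω, H Ω⟩`: integrate the pointwise bounds, swap the
integrals (Tonelli) and use that every translate `Ω(· + t𝟙)` has the energy of `Ω` (shift of the
fundamental cell). [folklore] -/
theorem lintegral_boseEnergyDensity_sqrtTransAvg_le {v : ℝ → ℝ≥0∞} (hv : Measurable v)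
    (hL : 0 < L) (Ω : PeriodicTrialState M L) {ε : ℝ} (hε : 0 < ε) :
    ∫⁻ X in cellN M L,
        (kineticDensity (fun Y : Config M =>
            ((Real.sqrt (ε ^ 2 + ∫ t in cell L, ‖Ω.ψ (Y + fun _ => t)‖ ^ 2) - ε : ℝ) : ℂ)) X +
          periodicInteraction v L X *
            ((‖((Real.sqrt (ε ^ 2 + ∫ t in cell L, ‖Ω.ψ (X + fun _ => t)‖ ^ 2) - ε : ℝ) : ℂ)‖₊ :
              ℝ≥0∞)) ^ 2) ≤
      ENNReal.ofReal L ^ 3 * periodicEnergy v Ω := by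
  set D : Config M → ℝ≥0∞ := fun X =>
    kineticDensity Ω.ψ X + periodicInteraction v L X * ((‖Ω.ψ X‖₊ : ℝ≥0∞)) ^ 2 with hD_def
  have hD : Measurable D := measurable_energyIntegrand hv L Ω.contDiff.continuous
  have hDper : ∀ (X : Config M) (i : Fin M) (k : Fin 3),
      D (X + Pi.single i (EuclideanSpace.single k L)) = D X := fun X i k => by
    simp only [hD_def, Ω.kineticDensity_add_single, periodicInteraction_add_single, Ω.periodic]
  calc _ ≤ ∫⁻ X in cellN M L, ∫⁻ t in cell L, D (X + fun _ => t) := by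
        refine lintegral_mono fun X => ?_
        have hmk : Measurable fun t : Space => kineticDensity Ω.ψ (X + fun _ => t) :=
          (measurable_kineticDensity_of_any Ω.ψ).comp
            (measurable_const.add continuous_diagConfig.measurable)
        simp only [hD_def]
        rw [lintegral_add_left hmk]
        exact add_le_add (kineticDensity_sqrtTransAvg_le Ω hε X)
          (periodicInteraction_mul_sqrtTransAvg_le v Ω hε X)
    _ = ENNReal.ofReal L ^ 3 * ∫⁻ X in cellN M L, D X :=
        lintegral_cellN_lintegral_cell_comp_add hL hD hDper
    _ = ENNReal.ofReal L ^ 3 * periodicEnergy v Ω := by rw [periodicEnergy]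

/-! ### The stub -/

/-- **Stub `stub_boseZeroMomentumAttain` of crux `RecoilTransfer` (route `BECProbeMassFlow`), exact
registered signature: the periodic `M`-boson ground-state energy is approached in the sector of
total momentum `0`.** For measurable `v ≥ 0` (hard cores allowed), `0 < L`, any `M` and any `δ > 0`
there is a Bose trial state `Ω₀` of total momentum `0` (`Ω₀(x₁ + s, …, x_M + s) = Ω₀(X)`) with
`⟨Ω₀, H Ω₀⟩ ≤ E(M, L) + δ`: the normalised regularised root of the translation-averaged density of
a near-minimiser (no Perron–Frobenius; the constant state if `E = ⊤`). [folklore] -/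
theorem stub_boseZeroMomentumAttain :
    ∀ v : ℝ → ℝ≥0∞, Measurable v → ∀ (M : ℕ) (L : ℝ), 0 < L → ∀ δ : ℝ≥0∞, 0 < δ →
      ∃ Ω₀ : PeriodicTrialState M L, HasTotalMomentum 0 Ω₀.ψ ∧
        periodicEnergy v Ω₀ ≤ periodicGroundStateEnergy v M L + δ := by
  intro v hv M L hL δ hδ
  have hL3 : ENNReal.ofReal L ^ 3 ≠ 0 := pow_ne_zero _ (ENNReal.ofReal_pos.2 hL).ne'
  have hL3' : ENNReal.ofReal L ^ 3 ≠ ⊤ := ENNReal.pow_ne_top ENNReal.ofReal_ne_top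
  by_cases hE : periodicGroundStateEnergy v M L = ⊤
  · -- the normalised constant state
    have h1 : ∫⁻ X in cellN M L, ((‖(1 : ℂ)‖₊ : ℝ≥0∞)) ^ 2 = (ENNReal.ofReal L ^ 3) ^ M := by
      rw [setLIntegral_const, volume_cellN, nnnorm_one, ENNReal.coe_one, one_pow, one_mul]
    obtain ⟨Ω₀, a, hΩ₀, -⟩ := exists_periodicTrialState_const_mul (L := L)
      (u := fun _ : Config M => (1 : ℂ)) contDiff_const (fun _ _ _ => rfl) (fun _ _ => rfl)
      (by rw [h1]; exact pow_ne_zero _ hL3) (by rw [h1]; exact ENNReal.pow_ne_top hL3')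
    refine ⟨Ω₀, hasTotalMomentum_zero_iff.2 fun s X => by rw [hΩ₀], ?_⟩
    rw [hE, top_add]
    exact le_top
  obtain ⟨Ω, hΩ⟩ : ∃ Ω : PeriodicTrialState M L,
      periodicEnergy v Ω < periodicGroundStateEnergy v M L + δ :=
    iInf_lt_iff.1 (ENNReal.lt_add_right hE hδ.ne')
  -- the regularised translation averages `g_n`, `ε = 1/(n+1)`, and their norms `I n`
  set I : ℕ → ℝ≥0∞ := fun n => ∫⁻ X in cellN M L,
    ((‖((Real.sqrt ((1 / ((n : ℝ) + 1)) ^ 2 + ∫ t in cell L, ‖Ω.ψ (X + fun _ => t)‖ ^ 2) -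
      (1 / ((n : ℝ) + 1)) : ℝ) : ℂ)‖₊ : ℝ≥0∞)) ^ 2 with hI_def
  have h1top : ∫⁻ X in cellN M L, ((‖Ω.ψ X‖₊ : ℝ≥0∞)) ^ 2 ≠ ⊤ := by
    rw [Ω.norm_eq]; exact ENNReal.one_ne_top
  have hI : Tendsto I atTop (𝓝 (ENNReal.ofReal L ^ 3)) := by
    have h := tendsto_lintegral_nnnorm_sqrtTransAvg_sq hL Ω.contDiff Ω.periodic h1top
    rwa [Ω.norm_eq, mul_one] at h
  have hItop : ∀ n, I n ≠ ⊤ := fun n =>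
    ne_top_of_le_ne_top (ENNReal.mul_ne_top hL3' h1top)
      (lintegral_nnnorm_sqrtTransAvg_sq_le hL Ω.contDiff.continuous Ω.periodic
        Nat.one_div_pos_of_nat.le)
  -- eventually `0 < I n` and `(I n)⁻¹ L³ ⟨Ω, H Ω⟩ < E + δ`
  have hev1 : ∀ᶠ n in atTop, 0 < I n := hI.eventually_const_lt (pos_iff_ne_zero.2 hL3)
  have hlim : Tendsto (fun n => (I n)⁻¹ * (ENNReal.ofReal L ^ 3 * periodicEnergy v Ω))
      atTop (𝓝 ((ENNReal.ofReal L ^ 3)⁻¹ * (ENNReal.ofReal L ^ 3 * periodicEnergy v Ω))) :=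
    ENNReal.Tendsto.mul_const (tendsto_inv_iff.2 hI) (Or.inl (ENNReal.inv_ne_zero.2 hL3'))
  rw [← mul_assoc, ENNReal.inv_mul_cancel hL3 hL3', one_mul] at hlim
  obtain ⟨n, hn0, hn⟩ := (hev1.and (hlim.eventually_lt_const hΩ)).exists
  -- the normalised state `g_n / ‖g_n‖`
  have hε : (0 : ℝ) < 1 / ((n : ℝ) + 1) := Nat.one_div_pos_of_nat
  have hgC := contDiff_sqrtTransAvg (L := L) Ω.contDiff hε
  obtain ⟨Ω₀, a, hΩ₀, ha⟩ := exists_periodicTrialState_const_mul hgC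
    (fun X i k => sqrtTransAvg_add_single Ω.periodic _ X i k)
    (fun σ X => sqrtTransAvg_comp_perm (Ω.symm σ) _ X) hn0.ne' (hItop n)
  refine ⟨Ω₀, ?_, ?_⟩
  · rw [hΩ₀]
    exact (hasTotalMomentum_zero_sqrtTransAvg hL Ω.contDiff.continuous Ω.periodic _).const_mul _
  · rw [periodicEnergy, hΩ₀]
    refine (lintegral_periodicEnergy_const_mul v L _ hgC).trans_le ?_
    rw [ha]
    exact (mul_le_mul_right (lintegral_boseEnergyDensity_sqrtTransAvg_le hv hL Ω hε) _).trans hn.le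

end Summit.AtomisticToContinuum.BoseEinsteinCondensation.Theorems

end
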